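import Summits.ResolutionOfSingularities.ResolutionOfSingularities.Theorems.MarkedTransferCampaignW31OrdPowCutDown
import Literature.AlgebraicGeometry.Hironaka2017.Proofs.S06BaseHike.U30L4c
import HarnessLib

/-!
# [OURS · L1 W3.1] The GUARDED halves of ⟨RegularCut⟩ / ⟨OrdPowCut⟩ (binders of `RegularCut_ours` + the guard `0 < b̂`)
# and the hierarchy REGULAR ⇒ ORD-POW ⇒ STABLE of R12/12a premises, per `(E, ed)` and as named residuals

Cell `res-hironaka`, rung L, slot W3.1 aftercare (OURS typer o4), answering the G3 lead's requests on STATUS (res-adj-3, reply to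
o4 ≈2026-08-27T00:45Z, points (4) «please add the guarded per-E siblings [of the `Hat` decls]» and BINDER SHAPE «consumers
should bind the PER-(E, ed) forms … at (Sing(Ê)_cl, invField Ê ed), not the ∀E Props»). Companion of p476257
(`…W31RegularCut.lean`) and p480089 (`…W31OrdPowCutDown.lean`); uses res-type-010's tower analysis `Lib/CoreFocusTower.lean`
(p479433) and `Proofs/S06BaseHike/U30L4c.lean` (p479791, the ⟨StableCut⟩ binder of `S06BaseHike.U30_2_R2_inst_of_stableCut`).

* OURS defs (desk lanes): `CampaignW31.HatStratumClosedPos` / `HatClosureRegularPos` / `HatClosureOrdPowPos` — the three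
  halves of p476257/p480089 with the extra guard `0 < (baseHike E).b` (= `U30_2_R2_inst`'s own guard, excluding row 009's junk
  value `Ê = (J, 0)`), in EXACTLY the binder order of res-type-010's ⟨StableCut⟩; `CampaignW31.HatStableCutPos` = that
  ⟨StableCut⟩ binder BY NAME (Summits-side name only; the Literature binder of record stays inline); `p`-slices `…PosI p` at
  row 005 part b's provenance.
* Kernel plumbing: unguarded ⇒ guarded; the hierarchy `HatClosureRegularPos ⇒ HatClosureOrdPowPos` and
  `HatStratumClosedPos ∧ HatClosureOrdPowPos ⇒ HatStableCutPos ⇒ U30_2_R2_inst` (via `stableAt_one_of_ordPowAlong` =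
  res-type-010's `stableAt_one_of_diffPower_le_pow` read through `ordPowAlong_iff_diffPower_eq_pow`); the guarded closedness
  half UNCONDITIONALLY from slot W3.1's consequence statement (`hatStratumClosedPos_of_invmaxClosed`; `p`-slice from
  `CampaignW31InvmaxClosedI p`, which seats pv-1/pv-3 prove modulo the dictionary / `U19_4_R2`); and the PER-`(E, ed)` binder
  forms `isCoreFocus_cutDown_of_closed_of_regular` / `_of_ordPow`, `stableAt_one_of_closed_of_ordPow` (no `∀ E` hypothesis:
  one bad `E` elsewhere cannot make a consumer vacuous).

HONEST FRAMING. Everything here is OURS (theorems about OUR typed definitions; `U30_2_R2_inst`, `IsCoreFocus`, `StableAt`,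
`focusAt`, `cutDown` are res-type-010's typings/constructions for §6.2 p.30 l.4–9, EXISTENCE of `Ě` NOT SHOWN IN PRINT).
NOTHING below is a statement of H. Hironaka's manuscript [Hironaka2017]; nothing of it is asserted; it stays «under review».
The `…Pos` residuals are CANDIDATE premises with no argument on record either way; VACUITY: each is implied by its unguarded
sibling and differs from it only at `Ê.b = 0`, which `baseHike` produces only as row 009's documented junk value — so none is
trivially true or false for a new reason (see p476257's module docstring for the specimens). AI bookkeeping; weaker than
expert review.

## References (context; nothing below is used as a premise)
* H. Hironaka, ms. 2017-03-23, §6.2 p.30 l.4–9, Eq. (43) — scope only, under adjudication. [Hironaka2017]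
* Cell records: res-adj-3 reply to o4 (STATUS l.18489); res-type-010 EVIDENCE R12 #5 2026-08-27T00:55:33Z (p478949, p479433,
  p479791); o4 p476257 / p480089; res-L1-k31 p467881; res-L1-s31-pv-2 `…W31ECheckOfUsc.lean`.
-/

noncomputable section

set_option linter.dupNamespace false -- mandated namespace of this single-conjunct summit

open _root_.AlgebraicGeometry _root_.TopologicalSpace _root_.CategoryTheory

namespace Summit.ResolutionOfSingularities.ResolutionOfSingularities.Theorems

open Literature.AlgebraicGeometry.Resolution
open Literature.AlgebraicGeometry.Hironaka2017
open Literature.AlgebraicGeometry.Hironaka2017.S02Preliminaries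
open Literature.AlgebraicGeometry.Hironaka2017.S04CharAlgebra
open Literature.AlgebraicGeometry.Hironaka2017.S06BaseHike
open Literature.AlgebraicGeometry.Hironaka2017.Datum

universe u

namespace CampaignW31

/-! ## Generic: `OrdPowAlong` ⇒ res-type-010's tower is stable at level 1 -/

section Generic

variable {Z : Scheme.{u}} {n : ℕ}

/-- `OrdPowAlong C` in the inline hypothesis shape of res-type-010's `Lib/CoreFocusTower` ORD-POW lemmas
(`∀ b > 0, 𝓘_C^{⟨b⟩} ≤ 𝓘_C^b`). [folklore] -/
theorem diffPower_le_pow_of_ordPowAlong (C : Closeds Z) (h : OrdPowAlong C) :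
    ∀ b : ℕ, 0 < b → diffPower C b ≤ Scheme.IdealSheafData.vanishingIdeal C ^ b :=
  fun b _ => ((ordPowAlong_iff_diffPower_eq_pow C).mp h b).le

/-- **`OrdPowAlong C` ⇒ the tower of candidates `focusAt Ê C ·` is STABLE AT LEVEL 1** (regular locally Noetherian `Z`,
`0 < d`): res-type-010's `stableAt_one_of_diffPower_le_pow` read through the typed name. So an ORD-POW cut is one sufficient
condition for ⟨StableCut⟩, as a regular cut is (`stableAt_one_of_regular`). [folklore] -/
theorem stableAt_one_of_ordPowAlong [IsLocallyNoetherian Z] (hR : Scheme.IsRegular Z) (Ehat : IdealExponent Z)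
    (hd : 0 < Ehat.b) (C : Closeds Z) (h : OrdPowAlong C) : StableAt Ehat C 1 :=
  stableAt_one_of_diffPower_le_pow hR Ehat hd C (diffPower_le_pow_of_ordPowAlong C h)

end Generic

/-! ## Per-`(E, ed)` binder forms on the ambient datum (what consumers bind; no `∀ E` hypothesis) -/

section PerE

variable {p : ℕ} [Fact p.Prime] {K : Type u} [Field K] [CharP K p] {n : ℕ}

/-- The ambient scheme of a row-001 `AmbientDatum` is locally Noetherian. [folklore] -/
private theorem ambient_isLocallyNoetherian (A : AmbientDatum p K) : IsLocallyNoetherian A.Z :=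
  -- adapted from Literature/AlgebraicGeometry/Hironaka2017/Proofs/S06BaseHike/U30L4c.lean (private)
  haveI := A.smooth
  haveI := A.quasiCompact
  haveI := Scheme.isNoetherian_of_finiteType_over_field A.hom
  inferInstance

/-- **Per `(E, ed)`, REGULAR door**: for a standard-or-not `E` on the ambient datum with `0 < Ê.b` and ANY family `ed` of edge
data of `Ê = baseHike E` on `Sing(Ê)_cl`: if the `Inv_max`-stratum of `ξ ↦ Inv_ξ(Ê)` is the trace of a closed set and its
closure `Σ̄_max` (reduced structure) is regular, then `cutDown Ê Σ̄_max` is a core focusing of `Ê` for `Inv := invInst Ê ed`.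
[folklore] -/
theorem isCoreFocus_cutDown_of_closed_of_regular (A : AmbientDatum p K) (E : IdealExponent A.Z)
    (ed : EdgeDataOn p n (baseHike E)) (hd : 0 < (baseHike E).b)
    (hcl : StratumRelClosedOn ((baseHike E).sing ∩ S02Preliminaries.closedPoints A.Z) (invField (baseHike E) ed))
    (hreg : InvmaxClosureRegularOn ((baseHike E).sing ∩ S02Preliminaries.closedPoints A.Z) (invField (baseHike E) ed)) :
    IsCoreFocus S04CharAlgebra.pAlg (invInst (baseHike E) ed) (baseHike E)
      (cutDown (baseHike E)
        (invmaxClosure ((baseHike E).sing ∩ S02Preliminaries.closedPoints A.Z) (invField (baseHike E) ed))) :=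
  isCoreFocus_cutDown_invmaxClosure_ambient A (invInst (baseHike E) ed) (baseHike E) hd hcl
    (ordPowAlong_of_isRegular_ambient A hreg)

/-- **Per `(E, ed)`, ORD-POW door**: same, with «`Σ̄_max` regular» replaced by `OrdPowAlong Σ̄_max`. [folklore] -/
theorem isCoreFocus_cutDown_of_closed_of_ordPow (A : AmbientDatum p K) (E : IdealExponent A.Z)
    (ed : EdgeDataOn p n (baseHike E)) (hd : 0 < (baseHike E).b)
    (hcl : StratumRelClosedOn ((baseHike E).sing ∩ S02Preliminaries.closedPoints A.Z) (invField (baseHike E) ed))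
    (hop : OrdPowAlong
      (invmaxClosure ((baseHike E).sing ∩ S02Preliminaries.closedPoints A.Z) (invField (baseHike E) ed))) :
    IsCoreFocus S04CharAlgebra.pAlg (invInst (baseHike E) ed) (baseHike E)
      (cutDown (baseHike E)
        (invmaxClosure ((baseHike E).sing ∩ S02Preliminaries.closedPoints A.Z) (invField (baseHike E) ed))) :=
  isCoreFocus_cutDown_invmaxClosure_ambient A (invInst (baseHike E) ed) (baseHike E) hd hcl hop

/-- **Per `(E, ed)`, ORD-POW ⇒ STABLE**: `OrdPowAlong Σ̄_max` puts res-type-010's tower of candidates over `Σ̄_max` in the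
stable case at level `1` (`0 < Ê.b`). [folklore] -/
theorem stableAt_one_of_closed_of_ordPow (A : AmbientDatum p K) (E : IdealExponent A.Z)
    (ed : EdgeDataOn p n (baseHike E)) (hd : 0 < (baseHike E).b)
    (hop : OrdPowAlong
      (invmaxClosure ((baseHike E).sing ∩ S02Preliminaries.closedPoints A.Z) (invField (baseHike E) ed))) :
    StableAt (baseHike E)
      (invmaxClosure ((baseHike E).sing ∩ S02Preliminaries.closedPoints A.Z) (invField (baseHike E) ed)) 1 :=
  haveI := ambient_isLocallyNoetherian A
  stableAt_one_of_ordPowAlong (AmbientDatum.isRegular_Z A) (baseHike E) hd _ hop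

end PerE

/-! ## The guarded halves as named residuals (binders of `RegularCut_ours` + `0 < b̂`) -/

section Hat

variable (IsEdgeData : ∀ ⦃X : Scheme.{u}⦄ ⦃p n : ℕ⦄ (E : IdealExponent X) (ξ : X), EdgeDatumAt p n E ξ → Prop)

/-- **[OURS · L1 W3.1] `CampaignW31.HatStratumClosedPos` — the CLOSEDNESS half, GUARDED**: replaces the role of the
presupposition of Eq. (43) p.30 l.8 that the `Inv_max`-stratum is a closed singular locus; NOT a statement of the manuscript.
Binders of `S06BaseHike.RegularCut_ours IsEdgeData A n` plus the guard `0 < (baseHike E).b` (binder order of res-type-010's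
⟨StableCut⟩, `U30L4c`): for every standard `E` with `0 < Ê.b` and every certified family `ed` on `Sing(Ê)_cl`, the
`Inv_max`-stratum of `ξ ↦ Inv_ξ(Ê)` is the trace on `Sing(Ê)_cl` of a closed set. FOLLOWS from slot W3.1's consequence
statement `CampaignW31InvmaxClosed IsEdgeData` (`hatStratumClosedPos_of_invmaxClosed`). [folklore] -/
def HatStratumClosedPos {p : ℕ} [Fact p.Prime] {K : Type u} [Field K] [CharP K p] [PerfectField K]
    (A : AmbientDatum p K) (n : ℕ) : Prop :=
  ∀ (E : IdealExponent A.Z) (ed : EdgeDataOn p n (baseHike E)), E.IsStandard → 0 < (baseHike E).b →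
    IsEdgeDataOn IsEdgeData (baseHike E) ed →
      StratumRelClosedOn ((baseHike E).sing ∩ S02Preliminaries.closedPoints A.Z) (invField (baseHike E) ed)

/-- **[OURS · L1 W3.1] `CampaignW31.HatClosureRegularPos` — the REGULARITY residual, GUARDED**: replaces the role of nothing
printed; NOT a statement of the manuscript. For every standard `E` with `0 < Ê.b` and every certified family `ed` on
`Sing(Ê)_cl`, the closure `Σ̄_max(Ê)` of the `Inv_max`-stratum (reduced structure) is REGULAR. CANDIDATE premise (the
unguarded `HatClosureRegular` implies it). [folklore] -/
def HatClosureRegularPos {p : ℕ} [Fact p.Prime] {K : Type u} [Field K] [CharP K p] [PerfectField K]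
    (A : AmbientDatum p K) (n : ℕ) : Prop :=
  ∀ (E : IdealExponent A.Z) (ed : EdgeDataOn p n (baseHike E)), E.IsStandard → 0 < (baseHike E).b →
    IsEdgeDataOn IsEdgeData (baseHike E) ed →
      InvmaxClosureRegularOn ((baseHike E).sing ∩ S02Preliminaries.closedPoints A.Z) (invField (baseHike E) ed)

/-- **[OURS · L1 W3.1] `CampaignW31.HatClosureOrdPowPos` — the ORD-POW residual, GUARDED**: replaces the role of nothing
printed; NOT a statement of the manuscript. For every standard `E` with `0 < Ê.b` and every certified family `ed` on
`Sing(Ê)_cl`, `OrdPowAlong Σ̄_max(Ê)`. CANDIDATE premise; implied by `HatClosureRegularPos`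
(`hatClosureOrdPowPos_of_hatClosureRegularPos`) and by the unguarded `HatClosureOrdPow`. [folklore] -/
def HatClosureOrdPowPos {p : ℕ} [Fact p.Prime] {K : Type u} [Field K] [CharP K p] [PerfectField K]
    (A : AmbientDatum p K) (n : ℕ) : Prop :=
  ∀ (E : IdealExponent A.Z) (ed : EdgeDataOn p n (baseHike E)), E.IsStandard → 0 < (baseHike E).b →
    IsEdgeDataOn IsEdgeData (baseHike E) ed →
      OrdPowAlong (invmaxClosure ((baseHike E).sing ∩ S02Preliminaries.closedPoints A.Z) (invField (baseHike E) ed))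

/-- **[OURS · L1 W3.1] `CampaignW31.HatStableCutPos` — res-type-010's ⟨StableCut⟩ BY NAME** (Summits-side name; the
Literature binder `hR12_StableCut` of `S06BaseHike.U30_2_R2_inst_of_stableCut`, `U30L4c` p479791, is this body VERBATIM and
stays the binder of record): for every standard `E` with `0 < Ê.b` and every certified `ed`, (i) `closure Σ_max ∩ Sing(Ê)_cl
= Σ_max` and (ii) the tower `focusAt Ê Σ̄_max ·` is stable at some positive level. Replaces the role of nothing printed; NOT a
statement of the manuscript. By res-type-010's `exists_isCoreFocus_iff_closure_ambient` it is, per `(E, ed)`, EQUIVALENT to the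
existence of `Ě`; implied by the ORD-POW halves (`hatStableCutPos_of_ordPowPos_halves`). CANDIDATE premise. [folklore] -/
def HatStableCutPos {p : ℕ} [Fact p.Prime] {K : Type u} [Field K] [CharP K p] [PerfectField K]
    (A : AmbientDatum p K) (n : ℕ) : Prop :=
  ∀ (E : IdealExponent A.Z) (ed : EdgeDataOn p n (baseHike E)), E.IsStandard → 0 < (baseHike E).b →
    IsEdgeDataOn IsEdgeData (baseHike E) ed →
      closure (invmaxStratum ((baseHike E).sing ∩ S02Preliminaries.closedPoints A.Z) (invField (baseHike E) ed)) ∩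
          ((baseHike E).sing ∩ S02Preliminaries.closedPoints A.Z) =
        invmaxStratum ((baseHike E).sing ∩ S02Preliminaries.closedPoints A.Z) (invField (baseHike E) ed) ∧
      ∃ b₀ : ℕ, 0 < b₀ ∧ StableAt (baseHike E) (Closeds.closure
        (invmaxStratum ((baseHike E).sing ∩ S02Preliminaries.closedPoints A.Z) (invField (baseHike E) ed))) b₀

variable {IsEdgeData}

/-- Pure logic: unguarded ⇒ guarded (closedness). [folklore] -/
theorem hatStratumClosedPos_of_hatStratumClosed {p : ℕ} [Fact p.Prime] {K : Type u} [Field K] [CharP K p]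
    [PerfectField K] {A : AmbientDatum p K} {n : ℕ} (h : HatStratumClosed IsEdgeData A n) :
    HatStratumClosedPos IsEdgeData A n :=
  fun E ed hE _ hed => h E ed hE hed

/-- Pure logic: unguarded ⇒ guarded (regularity). [folklore] -/
theorem hatClosureRegularPos_of_hatClosureRegular {p : ℕ} [Fact p.Prime] {K : Type u} [Field K] [CharP K p]
    [PerfectField K] {A : AmbientDatum p K} {n : ℕ} (h : HatClosureRegular IsEdgeData A n) :
    HatClosureRegularPos IsEdgeData A n :=
  fun E ed hE _ hed => h E ed hE hed

/-- Pure logic: unguarded ⇒ guarded (ord-pow). [folklore] -/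
theorem hatClosureOrdPowPos_of_hatClosureOrdPow {p : ℕ} [Fact p.Prime] {K : Type u} [Field K] [CharP K p]
    [PerfectField K] {A : AmbientDatum p K} {n : ℕ} (h : HatClosureOrdPow IsEdgeData A n) :
    HatClosureOrdPowPos IsEdgeData A n :=
  fun E ed hE _ hed => h E ed hE hed

/-- REGULAR ⇒ ORD-POW, guarded residuals (ambient datum). [folklore] -/
theorem hatClosureOrdPowPos_of_hatClosureRegularPos {p : ℕ} [Fact p.Prime] {K : Type u} [Field K] [CharP K p]
    [PerfectField K] {A : AmbientDatum p K} {n : ℕ} (h : HatClosureRegularPos IsEdgeData A n) :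
    HatClosureOrdPowPos IsEdgeData A n :=
  fun E ed hE hb hed => ordPowAlong_of_isRegular_ambient A (h E ed hE hb hed)

/-- **Closedness ∧ ORD-POW ⇒ ⟨StableCut⟩** (guarded, binder for binder): the cut equation from `invmaxClosure_inter_eq`, the
stability at level `1` from `stableAt_one_of_closed_of_ordPow`. [folklore] -/
theorem hatStableCutPos_of_ordPowPos_halves {p : ℕ} [Fact p.Prime] {K : Type u} [Field K] [CharP K p]
    [PerfectField K] {A : AmbientDatum p K} {n : ℕ} (h₁ : HatStratumClosedPos IsEdgeData A n)
    (h₂ : HatClosureOrdPowPos IsEdgeData A n) : HatStableCutPos IsEdgeData A n :=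
  fun E ed hE hb hed =>
    ⟨invmaxClosure_inter_eq (h₁ E ed hE hb hed), 1, Nat.one_pos, stableAt_one_of_closed_of_ordPow A E ed hb (h₂ E ed hE hb hed)⟩

/-- Closedness ∧ REGULAR ⇒ ⟨StableCut⟩ (guarded). [folklore] -/
theorem hatStableCutPos_of_regularPos_halves {p : ℕ} [Fact p.Prime] {K : Type u} [Field K] [CharP K p]
    [PerfectField K] {A : AmbientDatum p K} {n : ℕ} (h₁ : HatStratumClosedPos IsEdgeData A n)
    (h₂ : HatClosureRegularPos IsEdgeData A n) : HatStableCutPos IsEdgeData A n :=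
  hatStableCutPos_of_ordPowPos_halves h₁ (hatClosureOrdPowPos_of_hatClosureRegularPos h₂)

/-- ⟨StableCut⟩ contains the guarded closedness half (its first conjunct, with `C := Σ̄_max`). [folklore] -/
theorem hatStratumClosedPos_of_hatStableCutPos {p : ℕ} [Fact p.Prime] {K : Type u} [Field K] [CharP K p]
    [PerfectField K] {A : AmbientDatum p K} {n : ℕ} (h : HatStableCutPos IsEdgeData A n) :
    HatStratumClosedPos IsEdgeData A n :=
  fun E ed hE hb hed => ⟨_, isClosed_closure, (h E ed hE hb hed).1.symm⟩

/-- **The guarded closedness half FROM SLOT W3.1, unconditionally in the slot's terms**: the consequence statement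
`CampaignW31InvmaxClosed IsEdgeData` (slot file p463247: `Inv_max` attained and the stratum closed, every standard `E`, every
selection) gives `HatStratumClosedPos` at every ambient datum — the guard `0 < Ê.b` is exactly where p476257's
`hatStratumClosed_of_invmaxClosed` lives. [folklore] -/
theorem hatStratumClosedPos_of_invmaxClosed (h : CampaignW31InvmaxClosed.{u} IsEdgeData) {p : ℕ} [Fact p.Prime]
    (K : Type u) [Field K] [CharP K p] [PerfectField K] (A : AmbientDatum p K) (n : ℕ) :
    HatStratumClosedPos IsEdgeData A n :=
  fun E ed hE hb hed => hatStratumClosed_of_invmaxClosed IsEdgeData h K A n E ed hE hb hed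

/-- `U30_2_R2_inst` from ⟨StableCut⟩ by name (res-type-010's `U30_2_R2_inst_of_stableCut`, re-pointed). [folklore] -/
theorem U30_2_R2_inst_of_hatStableCutPos {p : ℕ} [Fact p.Prime] {K : Type u} [Field K] [CharP K p] [PerfectField K]
    {A : AmbientDatum p K} {n : ℕ} (h : HatStableCutPos IsEdgeData A n) : U30_2_R2_inst IsEdgeData A n :=
  U30_2_R2_inst_of_stableCut IsEdgeData A n h

/-- `U30_2_R2_inst` from the guarded ORD-POW halves (p480089's `U30_2_R2_inst_of_guarded_ordPow_halves`, by name). [folklore] -/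
theorem U30_2_R2_inst_of_ordPowPos_halves {p : ℕ} [Fact p.Prime] {K : Type u} [Field K] [CharP K p] [PerfectField K]
    {A : AmbientDatum p K} {n : ℕ} (h₁ : HatStratumClosedPos IsEdgeData A n) (h₂ : HatClosureOrdPowPos IsEdgeData A n) :
    U30_2_R2_inst IsEdgeData A n :=
  U30_2_R2_inst_of_guarded_ordPow_halves IsEdgeData A n h₁ h₂

/-- `U30_2_R2_inst` from the guarded REGULAR halves. [folklore] -/
theorem U30_2_R2_inst_of_regularPos_halves {p : ℕ} [Fact p.Prime] {K : Type u} [Field K] [CharP K p] [PerfectField K]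
    {A : AmbientDatum p K} {n : ℕ} (h₁ : HatStratumClosedPos IsEdgeData A n) (h₂ : HatClosureRegularPos IsEdgeData A n) :
    U30_2_R2_inst IsEdgeData A n :=
  U30_2_R2_inst_of_ordPowPos_halves h₁ (hatClosureOrdPowPos_of_hatClosureRegularPos h₂)

end Hat

end CampaignW31

open CampaignW31

/-! ## Per-`p` slices at row 005 part b's provenance -/

/-- **[OURS · L1 W3.1] `CampaignW31HatStratumClosedPosI p`** — `p`-slice of the GUARDED closedness half at
`CampaignW31.edgeDataProvenance`. Replaces the role of the presupposition of Eq. (43) p.30 l.8; NOT a statement of the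
manuscript. FOLLOWS from `CampaignW31InvmaxClosedI p` (`campaignW31HatStratumClosedPosI_of_invmaxClosedI`). [folklore] -/
def CampaignW31HatStratumClosedPosI (p : ℕ) [Fact p.Prime] : Prop :=
  ∀ (K : Type u) [Field K] [CharP K p] [PerfectField K] (A : AmbientDatum p K) (n : ℕ),
    HatStratumClosedPos CampaignW31.edgeDataProvenance A n

/-- **[OURS · L1 W3.1] `CampaignW31HatClosureRegularPosI p`** — `p`-slice of the GUARDED regularity residual at
`CampaignW31.edgeDataProvenance`. Replaces the role of nothing printed; CANDIDATE premise; NOT a statement of the manuscript.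
[folklore] -/
def CampaignW31HatClosureRegularPosI (p : ℕ) [Fact p.Prime] : Prop :=
  ∀ (K : Type u) [Field K] [CharP K p] [PerfectField K] (A : AmbientDatum p K) (n : ℕ),
    HatClosureRegularPos CampaignW31.edgeDataProvenance A n

/-- **[OURS · L1 W3.1] `CampaignW31HatClosureOrdPowPosI p`** — `p`-slice of the GUARDED ORD-POW residual at
`CampaignW31.edgeDataProvenance`. Replaces the role of nothing printed; CANDIDATE premise; NOT a statement of the manuscript.
[folklore] -/
def CampaignW31HatClosureOrdPowPosI (p : ℕ) [Fact p.Prime] : Prop :=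
  ∀ (K : Type u) [Field K] [CharP K p] [PerfectField K] (A : AmbientDatum p K) (n : ℕ),
    HatClosureOrdPowPos CampaignW31.edgeDataProvenance A n

/-- **[OURS · L1 W3.1] `CampaignW31HatStableCutPosI p`** — `p`-slice of ⟨StableCut⟩ by name at `CampaignW31.edgeDataProvenance`.
Replaces the role of nothing printed; CANDIDATE premise (per `(E, ed)` equivalent to the existence of `Ě`, res-type-010); NOT a
statement of the manuscript. [folklore] -/
def CampaignW31HatStableCutPosI (p : ℕ) [Fact p.Prime] : Prop :=
  ∀ (K : Type u) [Field K] [CharP K p] [PerfectField K] (A : AmbientDatum p K) (n : ℕ),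
    HatStableCutPos CampaignW31.edgeDataProvenance A n

/-- **The guarded closedness half, `p`-slice, FROM W3.1's `CampaignW31InvmaxClosedI p`** (which seats res-L1-s31-pv-1/pv-3 prove
modulo the dictionary / `U19_4_R2`; res-L1-k31's assembly gives it from the slot statement). [folklore] -/
theorem campaignW31HatStratumClosedPosI_of_invmaxClosedI (p : ℕ) [Fact p.Prime] (h : CampaignW31InvmaxClosedI.{u} p) :
    CampaignW31HatStratumClosedPosI.{u} p :=
  fun K _ _ _ A n E ed hE hb hed => campaignW31HatStratumClosedI_of_invmaxClosedI p h K A n E ed hE hb hed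

/-- … and from the SLOT STATEMENT `CampaignW31UscInvOneExponentI p` (res-L1-k31 p467881). [folklore] -/
theorem campaignW31HatStratumClosedPosI_of_uscInvOneExponentI (p : ℕ) [Fact p.Prime]
    (h : CampaignW31UscInvOneExponentI.{u} p) : CampaignW31HatStratumClosedPosI.{u} p :=
  campaignW31HatStratumClosedPosI_of_invmaxClosedI p (campaignW31InvmaxClosedI_of_uscInvOneExponentI p h)

/-- REGULAR ⇒ ORD-POW, guarded `p`-slices. [folklore] -/
theorem campaignW31HatClosureOrdPowPosI_of_regularPosI (p : ℕ) [Fact p.Prime]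
    (h : CampaignW31HatClosureRegularPosI.{u} p) : CampaignW31HatClosureOrdPowPosI.{u} p :=
  fun K _ _ _ A n => hatClosureOrdPowPos_of_hatClosureRegularPos (h K A n)

/-- Unguarded ⇒ guarded, regular residual `p`-slices. [folklore] -/
theorem campaignW31HatClosureRegularPosI_of_hatClosureRegularI (p : ℕ) [Fact p.Prime]
    (h : CampaignW31HatClosureRegularI.{u} p) : CampaignW31HatClosureRegularPosI.{u} p :=
  fun K _ _ _ A n => hatClosureRegularPos_of_hatClosureRegular (h K A n)

/-- Unguarded ⇒ guarded, ORD-POW residual `p`-slices. [folklore] -/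
theorem campaignW31HatClosureOrdPowPosI_of_hatClosureOrdPowI (p : ℕ) [Fact p.Prime]
    (h : CampaignW31HatClosureOrdPowI.{u} p) : CampaignW31HatClosureOrdPowPosI.{u} p :=
  fun K _ _ _ A n => hatClosureOrdPowPos_of_hatClosureOrdPow (h K A n)

/-- Closedness ∧ ORD-POW ⇒ ⟨StableCut⟩, `p`-slices. [folklore] -/
theorem campaignW31HatStableCutPosI_of_ordPow_halves (p : ℕ) [Fact p.Prime]
    (h₁ : CampaignW31HatStratumClosedPosI.{u} p) (h₂ : CampaignW31HatClosureOrdPowPosI.{u} p) :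
    CampaignW31HatStableCutPosI.{u} p :=
  fun K _ _ _ A n => hatStableCutPos_of_ordPowPos_halves (h₁ K A n) (h₂ K A n)

/-- **[OURS · L1 W3.1 → D-lane] existence of `Ě` from ⟨StableCut⟩ by name**, `p`-slice. [folklore] -/
theorem U30_2_R2_inst_of_hatStableCutPosI (p : ℕ) [Fact p.Prime] (h : CampaignW31HatStableCutPosI.{u} p)
    (K : Type u) [Field K] [CharP K p] [PerfectField K] (A : AmbientDatum p K) (n : ℕ) :
    U30_2_R2_inst CampaignW31.edgeDataProvenance A n :=
  U30_2_R2_inst_of_hatStableCutPos (h K A n)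

/-- **[OURS · L1 W3.1 → D-lane] existence of `Ě` FROM THE SLOT STATEMENT and the GUARDED ORD-POW residual**:
`CampaignW31UscInvOneExponentI p → CampaignW31HatClosureOrdPowPosI p → ∀ K A n, U30_2_R2_inst edgeDataProvenance A n`.
[folklore] -/
theorem U30_2_R2_inst_of_usc_and_closureOrdPowPos (p : ℕ) [Fact p.Prime]
    (h₁ : CampaignW31UscInvOneExponentI.{u} p) (h₂ : CampaignW31HatClosureOrdPowPosI.{u} p)
    (K : Type u) [Field K] [CharP K p] [PerfectField K] (A : AmbientDatum p K) (n : ℕ) :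
    U30_2_R2_inst CampaignW31.edgeDataProvenance A n :=
  U30_2_R2_inst_of_ordPowPos_halves (campaignW31HatStratumClosedPosI_of_uscInvOneExponentI p h₁ K A n) (h₂ K A n)

/-- … and from the GUARDED REGULAR residual. [folklore] -/
theorem U30_2_R2_inst_of_usc_and_closureRegularPos (p : ℕ) [Fact p.Prime]
    (h₁ : CampaignW31UscInvOneExponentI.{u} p) (h₂ : CampaignW31HatClosureRegularPosI.{u} p)
    (K : Type u) [Field K] [CharP K p] [PerfectField K] (A : AmbientDatum p K) (n : ℕ) :
    U30_2_R2_inst CampaignW31.edgeDataProvenance A n :=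
  U30_2_R2_inst_of_usc_and_closureOrdPowPos p h₁ (campaignW31HatClosureOrdPowPosI_of_regularPosI p h₂) K A n

end Summit.ResolutionOfSingularities.ResolutionOfSingularities.Theorems

end
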